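import Summits.AnomalousDissipation.AnomalousDissipation.Theorems.SolenoidalFractalHomogenisationLagrangianStepFrameTestPiola
import Summits.AnomalousDissipation.AnomalousDissipation.Theorems.SolenoidalFractalHomogenisationLagrangianStepClosedWindow
import Summits.AnomalousDissipation.AnomalousDissipation.Theorems.SolenoidalFractalHomogenisationLagrangianStepFrameGroupLaw
import HarnessLib

/-!
# K1L_D (stmt-AnomalousDissipation-27980), `stub_Z7_alphaBeta` α-provider, (T1) sub-targets (C1)/(C2) on the CLOSED window
# (helper; `--supports … --as helper`; lead-k1l-onelevel-p1 g5)

p3 g8's smooth Piola `FrameForm.isDivFree_distort_frameG_iff` (p701021) and viscous conjugation `FrameForm.viscAdjVar_conj_frameG` (p700154)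
are stated for `u ∈ Icc 0 T`, `T < refresh (m+1)`; the clamped (T1) (memo L16) needs them on the CLOSED piece, `T ≤ refresh (m+1)`.  Their
generic displacement forms take three pointwise inputs: smooth `G` entries (`isSmooth_frameG_entry_closed`, `…ClosedWindow`), `J·G = 1`
(ALL times: `isUnit_frameJac`, `…FrameGroupLaw` — `sum_flowJac_mul_frameG_all`) and Piola (`sum_partialDeriv_frameG_eq_zero_closed`).  Hence
**`isDivFree_distort_frameG_iff_closed`** and **`viscAdjVar_conj_frameG_closed`**.  NOT a proof of the stub, of the crux, or of AD; rung F-D1.A0.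
-/

set_option linter.dupNamespace false  -- the summit-side namespace `Summit.AnomalousDissipation.AnomalousDissipation.…` repeats a component by design (D-0017)

noncomputable section

namespace Summit.AnomalousDissipation.AnomalousDissipation.Theorems.SolenoidalFractalHomogenisation.LagrangianStep.FrameConj

open Set Function MeasureTheory
open Literature.Analysis Literature.Analysis.FunctionSpaces Literature.Analysis.FunctionSpaces.Torus
open Literature.Analysis.FluidPDE Literature.Analysis.FluidPDE.LatticeShear
open Literature.Analysis.FluidPDE.LatticeShear (LagrangianLatticeCarrier)
open Summit.AnomalousDissipation.AnomalousDissipation.Theorems.SolenoidalFractalHomogenisation.LagrangianStep.FrameForm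
  (isDivFree_distort_comp_displacement_iff divergence_distort_comp_displacement viscAdjVar_conj_comp_displacement surjective_X)

variable {k : ℕ}

/-- **`J · G = 1` in coordinates, at ALL times** (`frameG = frameJac⁻¹`, `isUnit_frameJac`):
`Σ_c ((id + D disp)(e_c))_{a′} · G_{c a} = δ_{a′ a}`. -/
theorem sum_flowJac_mul_frameG_all (E : LagrangianLatticeCarrier k) (hR : E.LevelRegular) (m : ℕ) (t' s : ℝ)
    (y : UnitAddTorus (Fin 3)) (a a' : Fin 3) :
    ∑ c, ((ContinuousLinearMap.id ℝ (EuclideanSpace ℝ (Fin 3)) + Torus.fderiv (E.disp m t' s) y) (EuclideanSpace.single c 1)) a'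
      * frameG E m t' s y c a = if a' = a then 1 else 0 := by
  have hdet : IsUnit (frameJac E m t' s y).det := (Matrix.isUnit_iff_isUnit_det _).mp (isUnit_frameJac E hR m t' s y)
  have h := Matrix.mul_nonsing_inv _ hdet
  have h2 := congrFun (congrFun h a') a
  rw [Matrix.mul_apply, Matrix.one_apply] at h2
  have hfd : E.flowDeriv m t' s y = ContinuousLinearMap.id ℝ (EuclideanSpace ℝ (Fin 3)) + Torus.fderiv (E.disp m t' s) y := by
    rw [LagrangianLatticeCarrier.flowDeriv, fderiv_lift, proj_repr]
  rw [← hfd]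
  exact h2

/-- **(C1) on the closed window**: `∇·(frameG · (Φ ∘ X)) = 0 ↔ ∇·Φ = 0` for smooth `Φ`, `u ∈ Icc 0 T`, `T ≤ refresh (m+1)`. -/
theorem isDivFree_distort_frameG_iff_closed (E : LagrangianLatticeCarrier k) (hR : E.LevelRegular) {m : ℕ} (hF : E.IsFlow m) (j : ℤ)
    {T : ℝ} (hT : T ≤ E.refresh (m + 1)) {u : ℝ} (hu : u ∈ Icc 0 T) {Φ : UnitAddTorus (Fin 3) → EuclideanSpace ℝ (Fin 3)}
    (hΦ : IsSmooth Φ) :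
    Torus.IsDivFree (FluidPDE.Torus.distort (frameG E m ((j : ℝ) * E.refresh (m + 1) + u) ((j : ℝ) * E.refresh (m + 1)))
        (fun x => Φ (E.X m ((j : ℝ) * E.refresh (m + 1) + u) ((j : ℝ) * E.refresh (m + 1)) x)))
      ↔ Torus.IsDivFree Φ :=
  isDivFree_distort_comp_displacement_iff hΦ (hR.isSmooth_disp m _ _) (fun c a => isSmooth_frameG_entry_closed E hR hF j hT hu c a)
    (sum_flowJac_mul_frameG_all E hR m _ _) (sum_partialDeriv_frameG_eq_zero_closed E hR hF j hT hu) (surjective_X E hR m _ _)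

/-- (C1), pointwise form on the closed window: `div (frameG · (Φ ∘ X)) (y) = (div Φ)(X y)`. -/
theorem divergence_distort_frameG_closed (E : LagrangianLatticeCarrier k) (hR : E.LevelRegular) {m : ℕ} (hF : E.IsFlow m) (j : ℤ)
    {T : ℝ} (hT : T ≤ E.refresh (m + 1)) {u : ℝ} (hu : u ∈ Icc 0 T) {Φ : UnitAddTorus (Fin 3) → EuclideanSpace ℝ (Fin 3)}
    (hΦ : IsSmooth Φ) (y : UnitAddTorus (Fin 3)) :
    Torus.divergence (FluidPDE.Torus.distort (frameG E m ((j : ℝ) * E.refresh (m + 1) + u) ((j : ℝ) * E.refresh (m + 1)))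
        (fun x => Φ (E.X m ((j : ℝ) * E.refresh (m + 1) + u) ((j : ℝ) * E.refresh (m + 1)) x))) y
      = Torus.divergence Φ (E.X m ((j : ℝ) * E.refresh (m + 1) + u) ((j : ℝ) * E.refresh (m + 1)) y) :=
  divergence_distort_comp_displacement hΦ (hR.isSmooth_disp m _ _) (fun c a => isSmooth_frameG_entry_closed E hR hF j hT hu c a)
    (sum_flowJac_mul_frameG_all E hR m _ _) (sum_partialDeriv_frameG_eq_zero_closed E hR hF j hT hu) y

/-- **(C2) on the closed window**: `viscAdjVar (y ↦ 𝔸^{frameG y}) (Φ ∘ X) (y) = (viscAdj 𝔸 Φ)(X y)` for smooth `Φ`, `u ∈ Icc 0 T`,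
`T ≤ refresh (m+1)`. -/
theorem viscAdjVar_conj_frameG_closed (E : LagrangianLatticeCarrier k) (hR : E.LevelRegular) {m : ℕ} (hF : E.IsFlow m) (j : ℤ)
    {T : ℝ} (hT : T ≤ E.refresh (m + 1)) {u : ℝ} (hu : u ∈ Icc 0 T) (𝔸 : FluidPDE.Torus.Visc4 (Fin 3))
    {Φ : UnitAddTorus (Fin 3) → EuclideanSpace ℝ (Fin 3)} (hΦ : IsSmooth Φ) (y : UnitAddTorus (Fin 3)) :
    FluidPDE.Torus.viscAdjVar (fun y' => FluidPDE.Torus.Visc4.conj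
        (frameG E m ((j : ℝ) * E.refresh (m + 1) + u) ((j : ℝ) * E.refresh (m + 1)) y') 𝔸)
      (fun x => Φ (E.X m ((j : ℝ) * E.refresh (m + 1) + u) ((j : ℝ) * E.refresh (m + 1)) x)) y
      = FluidPDE.Torus.viscAdj 𝔸 Φ (E.X m ((j : ℝ) * E.refresh (m + 1) + u) ((j : ℝ) * E.refresh (m + 1)) y) :=
  viscAdjVar_conj_comp_displacement 𝔸 hΦ (hR.isSmooth_disp m _ _) (fun e b => isSmooth_frameG_entry_closed E hR hF j hT hu e b)
    (sum_flowJac_mul_frameG_all E hR m _ _) (sum_partialDeriv_frameG_eq_zero_closed E hR hF j hT hu) y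

end Summit.AnomalousDissipation.AnomalousDissipation.Theorems.SolenoidalFractalHomogenisation.LagrangianStep.FrameConj

end
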